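import Summits.Ventures.LatticeQCDFlow.Exactness.Phi4HMCCarreDuChamp
import Summits.Ventures.LatticeQCDFlow.Exactness.InvolutiveMetropolisEnergyBound
import Summits.Ventures.LatticeQCDFlow.Exactness.HMCMomentumMoments
import Summits.Ventures.LatticeQCDFlow.Exactness.Phi4HMCEnergyViolationIntegrable
import Summits.Ventures.LatticeQCDFlow.Exactness.Phi4MetropolisActionCSD
import HarnessLib

/-!
# CRITICAL SLOWING DOWN OF THE ACTION under HMC, typed: `τ_int,traj(f(S)) ≥ Var(f(S))/(2V + 8/e²) − ½` for EVERY trajectory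

HONEST FRAMING: exact (Metropolis-corrected) sampling algorithms for lattice gauge theory;
figures of merit are autocorrelation/cost numbers at stated couplings and volumes; no
continuum-physics claim.  (SCALAR calibration rung S0-A: not a gauge result.)

Venture `LatticeQCDFlow` (cell pub-lqcd), topic `Exactness`; FANOUT row 2 (`s0-phi4`, HMC arm — the
row's "dynamical exponents z" deliverable from the side of THEOREMS).  NEW WORK of the cell,
composing `InvolutiveMetropolisEnergyBound` (mean squared accepted change of the action
`≤ 16e^{−2} Z_H + 8 ∫ (K − c)² e^{−H}` for every kinetic-exchange update), `HMCMomentumMoments`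
(`Var(½Σp²) = V/2` under the refresh) and `Phi4HMCCarreDuChamp` (`τ_int ≥ 2 Var(f)/⟨(Δf)²⟩_acc − ½`).
Nothing is cited as a fact.  Printed neighbours, NAMED ONLY: Caracciolo–Pelissetto–Sokal 1994
(PRL 72:179: `τ_int,E ≥ const · C_H` for Metropolis-type algorithms with a configuration-space
energy; HMC's accept step tests the phase-space `H`, not `S`, so that theorem does not cover the
action under HMC — the kinetic-exchange step below is the cell's); Kennedy–Pendleton 2001
(NPB 607:456: free-field autocorrelations of quadratic operators, mode by mode).

## What is proved (`Λ = Fin (n+1)`, `V = n+1` sites, `H(φ,p) = S(φ) + ½Σp²`, `a = min(1, e^{−ΔH})`)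

For EVERY measurable Lebesgue-preserving involution `Ψ` of phase space (qpq / pqp leapfrog of any
step size and any length, any reversible volume-preserving integrator, the exact flow) and the
HMC-type update `K_Ψ = hmcOpOf J λ Ψ` (full Gaussian momentum refresh, propose `Ψ`, Metropolis test):

* `integrable_kinetic_dev_sq_mul_exp_neg`, `integral_exp_neg_phi4HmcEnergy`,
  `integral_kinetic_dev_sq_mul_exp_neg` — `∫∫ e^{−H} = Z Z_p`, `∫∫ (½Σp² − V/2)² e^{−H} = Z (V/2) Z_p`;
* **`hmc_action_msd_le`** — for every `f` with `|f ψ − f φ| ≤ |S ψ − S φ|` (any 1-Lipschitz function of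
  the action): `∫∫ a (f((Ψ z).1) − f(z.1))² e^{−H} ≤ (16e^{−2} + 4V) Z_p Z` — the action changes only
  by the energy violation (`≤ 8/e²` in mean square) and by what the refreshed kinetic energy can
  absorb (variance `V/2`);
* **`hmc_tauInt_ge_action`** — `λ > 0`, any `J`, any such `Ψ`, `f` bounded measurable moving no
  more than `S`, `g = f − ⟨f⟩`: summable autocorrelations with `ρ_g(1) < 1` ⇒
  `τ_int(f) ≥ ⟨(f − ⟨f⟩)²⟩ / (2V + 8e^{−2}) − ½` per update;
* `clipAction_lipschitz_global`, **`hmcPhi4_tauInt_ge_action`**, `hmcPQP_tauInt_ge_action`,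
  **`hmcPhi4_tauInt_ge_clipAction`** — row 2's qpq-leapfrog HMC (and the pqp variant), EVERY step
  size `δ` and trajectory length `N`, instance the clipped action `max(−c, min(c, S))` at every clip
  level `c`.

Reading (no numerics implied).  Per trajectory — whatever its length, step size or integrator — HMC
with complete momentum refreshment cannot decorrelate the action faster than
`τ_int,traj ≳ c_S/2 − ½`, `c_S = Var(S)/V` the specific-heat-like variance per site: longer
trajectories buy nothing for the energy beyond this floor, because the action can only trade
`O(√V)` with the freshly drawn kinetic energy.  Consequences: `z_int,S ≥ α/ν` in trajectory units
for the HMC arm (vacuous where `α ≤ 0`, e.g. the 2D Ising class has `c_S ∼ log L`); and in a regime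
of phase coexistence with action densities differing by `Δs` (`Var(S) ≈ V²Δs²/4`) the floor is
`≈ VΔs²/8` trajectories — tunnelling between such phases is frozen linearly in the volume for every
HMC-type update.  NOT CLAIMED: `ρ_g(1) < 1` / summability for any run (hypotheses); the unclipped
action (needs the polynomial-envelope class for `K_Ψ`); partial momentum refreshment (GHMC), which
exchanges even less kinetic energy and is not an instance of `hmcOpOf`; any value of `c_S`.
-/

namespace Summit.Ventures.LatticeQCDFlow.Exactness

open Real MeasureTheory Filter Finset
open Summit.Ventures.LatticeQCDFlow.Scoring

section ActionCSD

variable {n : ℕ}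

/-- `(½Σp² − c)² e^{−H}` is integrable on phase space (coercive action): it is dominated by
`(½ + |c|)² s(z)² e^{−H}`, `s` the size function of `Phi4LeapfrogGrowth`. -/
theorem integrable_kinetic_dev_sq_mul_exp_neg {J : Fin (n + 1) → Fin (n + 1) → ℝ} {lam ε K : ℝ}
    (hε : 0 < ε) (hS : ∀ φ : Fin (n + 1) → ℝ, ε * ∑ w, φ w ^ 2 - K ≤ latticePhi4Action J lam φ)
    (c : ℝ) :
    Integrable (fun z : (Fin (n + 1) → ℝ) × (Fin (n + 1) → ℝ) =>
      ((∑ x, z.2 x ^ 2) / 2 - c) ^ 2 * Real.exp (-phi4HmcEnergy J lam z))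
      ((volume : Measure (Fin (n + 1) → ℝ)).prod volume) := by
  have h := (integrable_phaseSize_pow_mul_exp_neg hε hS 1).const_mul ((1 / 2 + |c|) ^ 2)
  have hKm : Measurable fun z : (Fin (n + 1) → ℝ) × (Fin (n + 1) → ℝ) => (∑ x, z.2 x ^ 2) / 2 :=
    (Finset.measurable_sum _ fun x _ => ((measurable_pi_apply x).comp measurable_snd).pow_const 2).div_const 2
  refine Integrable.mono' h (((hKm.sub measurable_const).pow_const 2).mul
    (Real.measurable_exp.comp (measurable_phi4HmcEnergy J lam).neg)).aestronglyMeasurable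
    (Eventually.of_forall fun z => ?_)
  have hs1 := one_le_phaseSize z
  have hsp := sum_sq_snd_le_phaseSize z
  have hs0 : 0 ≤ ∑ x, z.2 x ^ 2 := Finset.sum_nonneg fun x _ => sq_nonneg _
  have hw0 : 0 ≤ Real.exp (-phi4HmcEnergy J lam z) := (Real.exp_pos _).le
  rw [Real.norm_eq_abs, abs_mul, abs_of_nonneg (sq_nonneg _), abs_of_nonneg hw0]
  have habs : |(∑ x, z.2 x ^ 2) / 2 - c| ≤ (1 / 2 + |c|) * phaseSize z := by
    calc |(∑ x, z.2 x ^ 2) / 2 - c| ≤ |(∑ x, z.2 x ^ 2) / 2| + |c| := abs_sub _ _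
      _ = (∑ x, z.2 x ^ 2) / 2 + |c| := by rw [abs_of_nonneg (by positivity)]
      _ ≤ phaseSize z / 2 + |c| * phaseSize z := by
          have : |c| * 1 ≤ |c| * phaseSize z := mul_le_mul_of_nonneg_left hs1 (abs_nonneg c)
          linarith
      _ = (1 / 2 + |c|) * phaseSize z := by ring
  have hsq : ((∑ x, z.2 x ^ 2) / 2 - c) ^ 2 ≤ (1 / 2 + |c|) ^ 2 * phaseSize z ^ (1 + 1) := by
    rw [← sq_abs, show (1 + 1 : ℕ) = 2 from rfl, ← mul_pow]
    exact pow_le_pow_left₀ (abs_nonneg _) habs 2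
  calc ((∑ x, z.2 x ^ 2) / 2 - c) ^ 2 * Real.exp (-phi4HmcEnergy J lam z)
      ≤ (1 / 2 + |c|) ^ 2 * phaseSize z ^ (1 + 1) * Real.exp (-phi4HmcEnergy J lam z) :=
        mul_le_mul_of_nonneg_right hsq hw0
    _ = (1 / 2 + |c|) ^ 2 * (phaseSize z ^ (1 + 1) * Real.exp (-phi4HmcEnergy J lam z)) := by ring

/-- `∫∫ e^{−H} = Z · Z_p`. -/
theorem integral_exp_neg_phi4HmcEnergy (J : Fin (n + 1) → Fin (n + 1) → ℝ) (lam : ℝ) :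
    ∫ z : (Fin (n + 1) → ℝ) × (Fin (n + 1) → ℝ), Real.exp (-phi4HmcEnergy J lam z)
        ∂((volume : Measure (Fin (n + 1) → ℝ)).prod volume) = gibbsZ J lam * momentumZ n := by
  simp_rw [exp_neg_phi4HmcEnergy]
  rw [integral_prod_mul]
  rfl

/-- **The kinetic energy absorbs `V/2` in mean square**: `∫∫ (½Σp² − (n+1)/2)² e^{−H} = Z · ((n+1)/2) Z_p`. -/
theorem integral_kinetic_dev_sq_mul_exp_neg (J : Fin (n + 1) → Fin (n + 1) → ℝ) (lam : ℝ) :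
    ∫ z : (Fin (n + 1) → ℝ) × (Fin (n + 1) → ℝ), ((∑ x, z.2 x ^ 2) / 2 - ((n : ℝ) + 1) / 2) ^ 2
        * Real.exp (-phi4HmcEnergy J lam z) ∂((volume : Measure (Fin (n + 1) → ℝ)).prod volume)
      = gibbsZ J lam * (((n : ℝ) + 1) / 2 * momentumZ n) := by
  have e : ∀ z : (Fin (n + 1) → ℝ) × (Fin (n + 1) → ℝ),
      ((∑ x, z.2 x ^ 2) / 2 - ((n : ℝ) + 1) / 2) ^ 2 * Real.exp (-phi4HmcEnergy J lam z)
      = gibbsWeight J lam z.1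
        * (((∑ x, z.2 x ^ 2) / 2 - ((n : ℝ) + 1) / 2) ^ 2 * momentumWeight z.2) := by
    intro z
    rw [exp_neg_phi4HmcEnergy]
    ring
  simp_rw [e]
  rw [integral_prod_mul (f := gibbsWeight J lam)
    (g := fun p : Fin (n + 1) → ℝ => ((∑ x, p x ^ 2) / 2 - ((n : ℝ) + 1) / 2) ^ 2 * momentumWeight p),
    integral_kinetic_dev_sq_mul_momentumWeight]
  rfl

/-- **THE MEAN SQUARED ACCEPTED CHANGE OF THE ACTION PER HMC-TYPE UPDATE IS AT MOST `16/e² + 4V`**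
(in units of `Z_p Z`).  Coercive action, `Ψ` any measurable Lebesgue-preserving involution of phase
space, `f` any observable with `|f ψ − f φ| ≤ |S ψ − S φ|`:
`∫∫ a(z) (f((Ψ z).1) − f(z.1))² e^{−H(z)} dz ≤ (16e^{−2} + 4(n+1)) · Z_p · Z`. -/
theorem hmc_action_msd_le {J : Fin (n + 1) → Fin (n + 1) → ℝ} {lam ε K : ℝ} (hε : 0 < ε)
    (hS : ∀ φ : Fin (n + 1) → ℝ, ε * ∑ w, φ w ^ 2 - K ≤ latticePhi4Action J lam φ)
    {Ψ : (Fin (n + 1) → ℝ) × (Fin (n + 1) → ℝ) → (Fin (n + 1) → ℝ) × (Fin (n + 1) → ℝ)}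
    (hΨm : Measurable Ψ) (hΨi : Function.Involutive Ψ)
    (hΨμ : MeasurePreserving Ψ ((volume : Measure (Fin (n + 1) → ℝ)).prod volume)
      ((volume : Measure (Fin (n + 1) → ℝ)).prod volume))
    {f : (Fin (n + 1) → ℝ) → ℝ}
    (hfS : ∀ ψ φ : Fin (n + 1) → ℝ, |f ψ - f φ| ≤ |latticePhi4Action J lam ψ - latticePhi4Action J lam φ|) :
    ∫ z, involAccept (phi4HmcEnergy J lam) Ψ z * (f (Ψ z).1 - f z.1) ^ 2
        * Real.exp (-phi4HmcEnergy J lam z) ∂((volume : Measure (Fin (n + 1) → ℝ)).prod volume)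
      ≤ (16 * Real.exp (-2) + 4 * ((n : ℝ) + 1)) * (momentumZ n * gibbsZ J lam) := by
  have hHm : Measurable (phi4HmcEnergy J lam) := measurable_phi4HmcEnergy J lam
  have hKm : Measurable fun z : (Fin (n + 1) → ℝ) × (Fin (n + 1) → ℝ) => (∑ x, z.2 x ^ 2) / 2 :=
    (Finset.measurable_sum _ fun x _ => ((measurable_pi_apply x).comp measurable_snd).pow_const 2).div_const 2
  have h := integral_involAccept_mul_sq_sub_le_of_kinetic
    (μ := ((volume : Measure (Fin (n + 1) → ℝ)).prod volume)) (H := phi4HmcEnergy J lam)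
    (S := fun z => latticePhi4Action J lam z.1) (K := fun z => (∑ x, z.2 x ^ 2) / 2) (Ψ := Ψ)
    hHm hKm hΨm hΨi hΨμ (fun z => rfl) (integrable_exp_neg_phi4HmcEnergy hε hS)
    (((n : ℝ) + 1) / 2) (integrable_kinetic_dev_sq_mul_exp_neg hε hS _)
    (f := fun z => f z.1) (fun z => hfS (Ψ z).1 z.1)
  rw [integral_exp_neg_phi4HmcEnergy, integral_kinetic_dev_sq_mul_exp_neg] at h
  calc _ ≤ 16 * Real.exp (-2) * (gibbsZ J lam * momentumZ n)
        + 8 * (gibbsZ J lam * (((n : ℝ) + 1) / 2 * momentumZ n)) := h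
    _ = (16 * Real.exp (-2) + 4 * ((n : ℝ) + 1)) * (momentumZ n * gibbsZ J lam) := by ring

/-- The bookkeeping `2 P/(16e^{−2} + 4V) = P/(2V + 8e^{−2})`. -/
theorem action_floor_transfer (n : ℕ) (P : ℝ) :
    2 * P / (16 * Real.exp (-2) + 4 * ((n : ℝ) + 1)) = P / (2 * ((n : ℝ) + 1) + 8 * Real.exp (-2)) := by
  have h1 : 0 < 16 * Real.exp (-2) + 4 * ((n : ℝ) + 1) := by positivity
  have h2 : 0 < 2 * ((n : ℝ) + 1) + 8 * Real.exp (-2) := by positivity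
  rw [div_eq_div_iff h1.ne' h2.ne']
  ring

/-- **THE ACTION FLOOR FOR EVERY HMC-TYPE UPDATE OF LATTICE φ⁴.**  Every `λ > 0`, every real `J`,
every measurable Lebesgue-preserving involution `Ψ` of phase space (any reversible volume-preserving
integrator, any step size, any trajectory length); `f` bounded measurable with
`|f ψ − f φ| ≤ |S ψ − S φ|`, `g = f − ⟨f⟩`, `ρ_g(k) = ∫ g (K_Ψᵏ g) e^{−S} / ∫ g² e^{−S}`.  If the
autocorrelation series of `g` is summable and `ρ_g(1) < 1`, then
`τ_int(f) = ½ + Σ_{k≥1} ρ_g(k) ≥ ⟨(f − ⟨f⟩)²⟩ / (2(n+1) + 8e^{−2}) − ½`  (per update). -/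
theorem hmc_tauInt_ge_action {lam : ℝ} (hlam : 0 < lam) (J : Fin (n + 1) → Fin (n + 1) → ℝ)
    {Ψ : (Fin (n + 1) → ℝ) × (Fin (n + 1) → ℝ) → (Fin (n + 1) → ℝ) × (Fin (n + 1) → ℝ)}
    (hΨm : Measurable Ψ) (hΨi : Function.Involutive Ψ)
    (hΨμ : MeasurePreserving Ψ ((volume : Measure (Fin (n + 1) → ℝ)).prod volume)
      ((volume : Measure (Fin (n + 1) → ℝ)).prod volume))
    {f : (Fin (n + 1) → ℝ) → ℝ} (hf : BddObs f)
    (hfS : ∀ ψ φ : Fin (n + 1) → ℝ, |f ψ - f φ| ≤ |latticePhi4Action J lam ψ - latticePhi4Action J lam φ|)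
    (hs : Summable fun k => (∫ φ, (f φ - gibbsExpect J lam f)
        * ((hmcOpOf J lam Ψ)^[k + 1] (fun ψ => f ψ - gibbsExpect J lam f)) φ * gibbsWeight J lam φ)
        / ∫ φ, (f φ - gibbsExpect J lam f) ^ 2 * gibbsWeight J lam φ)
    (hρ : (∫ φ, (f φ - gibbsExpect J lam f)
        * hmcOpOf J lam Ψ (fun ψ => f ψ - gibbsExpect J lam f) φ * gibbsWeight J lam φ)
        / (∫ φ, (f φ - gibbsExpect J lam f) ^ 2 * gibbsWeight J lam φ) < 1) :
    gibbsExpect J lam (fun φ => (f φ - gibbsExpect J lam f) ^ 2) / (2 * ((n : ℝ) + 1) + 8 * Real.exp (-2))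
        - 1 / 2
      ≤ tauInt (fun k => (∫ φ, (f φ - gibbsExpect J lam f)
          * ((hmcOpOf J lam Ψ)^[k] (fun ψ => f ψ - gibbsExpect J lam f)) φ * gibbsWeight J lam φ)
          / ∫ φ, (f φ - gibbsExpect J lam f) ^ 2 * gibbsWeight J lam φ) := by
  have hD := hmc_action_msd_le one_pos (latticePhi4Action_coercive hlam J) hΨm hΨi hΨμ hfS
  have h := hmc_tauInt_ge_of_msd_le hlam J hΨm hΨi hΨμ hf hD hs hρ
  rw [action_floor_transfer] at h
  exact h

/-- **Row 2's HMC (qpq leapfrog), EVERY step size `δ` and EVERY trajectory length `N`**: the action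
floor `τ_int,traj(f) ≥ Var(f)/(2(n+1) + 8e^{−2}) − ½` for every bounded measurable `f` moving no more
than the action. -/
theorem hmcPhi4_tauInt_ge_action {lam : ℝ} (hlam : 0 < lam) (J : Fin (n + 1) → Fin (n + 1) → ℝ)
    (δ : ℝ) (N : ℕ) {f : (Fin (n + 1) → ℝ) → ℝ} (hf : BddObs f)
    (hfS : ∀ ψ φ : Fin (n + 1) → ℝ, |f ψ - f φ| ≤ |latticePhi4Action J lam ψ - latticePhi4Action J lam φ|)
    (hs : Summable fun k => (∫ φ, (f φ - gibbsExpect J lam f)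
        * ((hmcOpPhi4 J lam δ N)^[k + 1] (fun ψ => f ψ - gibbsExpect J lam f)) φ * gibbsWeight J lam φ)
        / ∫ φ, (f φ - gibbsExpect J lam f) ^ 2 * gibbsWeight J lam φ)
    (hρ : (∫ φ, (f φ - gibbsExpect J lam f)
        * hmcOpPhi4 J lam δ N (fun ψ => f ψ - gibbsExpect J lam f) φ * gibbsWeight J lam φ)
        / (∫ φ, (f φ - gibbsExpect J lam f) ^ 2 * gibbsWeight J lam φ) < 1) :
    gibbsExpect J lam (fun φ => (f φ - gibbsExpect J lam f) ^ 2) / (2 * ((n : ℝ) + 1) + 8 * Real.exp (-2))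
        - 1 / 2
      ≤ tauInt (fun k => (∫ φ, (f φ - gibbsExpect J lam f)
          * ((hmcOpPhi4 J lam δ N)^[k] (fun ψ => f ψ - gibbsExpect J lam f)) φ * gibbsWeight J lam φ)
          / ∫ φ, (f φ - gibbsExpect J lam f) ^ 2 * gibbsWeight J lam φ) :=
  hmc_tauInt_ge_action hlam J (measurable_hmcProposal J lam δ N) (hmcProposal_involutive J lam δ N)
    (measurePreserving_hmcProposal J lam δ N) hf hfS hs hρ

/-- **The engine's secondary integrator (pqp leapfrog, `hmcpqp`) obeys the same action floor** —
every step size `δ`, every trajectory length `N`. -/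
theorem hmcPQP_tauInt_ge_action {lam : ℝ} (hlam : 0 < lam) (J : Fin (n + 1) → Fin (n + 1) → ℝ)
    (δ : ℝ) (N : ℕ) {f : (Fin (n + 1) → ℝ) → ℝ} (hf : BddObs f)
    (hfS : ∀ ψ φ : Fin (n + 1) → ℝ, |f ψ - f φ| ≤ |latticePhi4Action J lam ψ - latticePhi4Action J lam φ|)
    (hs : Summable fun k => (∫ φ, (f φ - gibbsExpect J lam f)
        * ((hmcOpPQP J lam δ N)^[k + 1] (fun ψ => f ψ - gibbsExpect J lam f)) φ * gibbsWeight J lam φ)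
        / ∫ φ, (f φ - gibbsExpect J lam f) ^ 2 * gibbsWeight J lam φ)
    (hρ : (∫ φ, (f φ - gibbsExpect J lam f)
        * hmcOpPQP J lam δ N (fun ψ => f ψ - gibbsExpect J lam f) φ * gibbsWeight J lam φ)
        / (∫ φ, (f φ - gibbsExpect J lam f) ^ 2 * gibbsWeight J lam φ) < 1) :
    gibbsExpect J lam (fun φ => (f φ - gibbsExpect J lam f) ^ 2) / (2 * ((n : ℝ) + 1) + 8 * Real.exp (-2))
        - 1 / 2
      ≤ tauInt (fun k => (∫ φ, (f φ - gibbsExpect J lam f)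
          * ((hmcOpPQP J lam δ N)^[k] (fun ψ => f ψ - gibbsExpect J lam f)) φ * gibbsWeight J lam φ)
          / ∫ φ, (f φ - gibbsExpect J lam f) ^ 2 * gibbsWeight J lam φ) :=
  hmc_tauInt_ge_action hlam J (measurable_hmcProposalPQP J lam δ N)
    (hmcProposalPQP_involutive J lam δ N) (measurePreserving_hmcProposalPQP J lam δ N) hf hfS hs hρ

/-- The clipped action moves no more than the action, between ANY two configurations. -/
theorem clipAction_lipschitz_global (J : Fin (n + 1) → Fin (n + 1) → ℝ) (lam c : ℝ)
    (ψ φ : Fin (n + 1) → ℝ) :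
    |max (-c) (min c (latticePhi4Action J lam ψ)) - max (-c) (min c (latticePhi4Action J lam φ))|
      ≤ |latticePhi4Action J lam ψ - latticePhi4Action J lam φ| :=
  Literature.Analysis.FunctionSpaces.abs_clamp_sub_clamp_le c _ _

/-- **THE HMC FLOOR FOR THE CLIPPED ACTION.**  Row 2's qpq-leapfrog HMC, every `λ > 0`, every real
`J`, EVERY step size `δ`, EVERY trajectory length `N`, every clip level `c`; `f_c = max(−c, min(c, S))`,
`g = f_c − ⟨f_c⟩`: summable autocorrelations with `ρ_g(1) < 1` ⇒
`τ_int,traj(f_c) ≥ Var(f_c)/(2(n+1) + 8e^{−2}) − ½`  (`Var(f_c)/(n+1) → Var(S)/(n+1) = c_S` as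
`c → ∞`: at least `≈ c_S/2 − ½` trajectories per independent value of the action). -/
theorem hmcPhi4_tauInt_ge_clipAction {lam : ℝ} (hlam : 0 < lam) (J : Fin (n + 1) → Fin (n + 1) → ℝ)
    (δ : ℝ) (N : ℕ) (c : ℝ)
    (hs : Summable fun k => (∫ φ, (max (-c) (min c (latticePhi4Action J lam φ))
          - gibbsExpect J lam (fun ψ => max (-c) (min c (latticePhi4Action J lam ψ))))
        * ((hmcOpPhi4 J lam δ N)^[k + 1] (fun ψ => max (-c) (min c (latticePhi4Action J lam ψ))
          - gibbsExpect J lam (fun ψ => max (-c) (min c (latticePhi4Action J lam ψ))))) φ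
        * gibbsWeight J lam φ)
        / ∫ φ, (max (-c) (min c (latticePhi4Action J lam φ))
          - gibbsExpect J lam (fun ψ => max (-c) (min c (latticePhi4Action J lam ψ)))) ^ 2
          * gibbsWeight J lam φ)
    (hρ : (∫ φ, (max (-c) (min c (latticePhi4Action J lam φ))
          - gibbsExpect J lam (fun ψ => max (-c) (min c (latticePhi4Action J lam ψ))))
        * hmcOpPhi4 J lam δ N (fun ψ => max (-c) (min c (latticePhi4Action J lam ψ))
          - gibbsExpect J lam (fun ψ => max (-c) (min c (latticePhi4Action J lam ψ)))) φ
        * gibbsWeight J lam φ)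
        / (∫ φ, (max (-c) (min c (latticePhi4Action J lam φ))
          - gibbsExpect J lam (fun ψ => max (-c) (min c (latticePhi4Action J lam ψ)))) ^ 2
          * gibbsWeight J lam φ) < 1) :
    gibbsExpect J lam (fun φ => (max (-c) (min c (latticePhi4Action J lam φ))
          - gibbsExpect J lam (fun ψ => max (-c) (min c (latticePhi4Action J lam ψ)))) ^ 2)
        / (2 * ((n : ℝ) + 1) + 8 * Real.exp (-2)) - 1 / 2
      ≤ tauInt (fun k => (∫ φ, (max (-c) (min c (latticePhi4Action J lam φ))
          - gibbsExpect J lam (fun ψ => max (-c) (min c (latticePhi4Action J lam ψ))))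
        * ((hmcOpPhi4 J lam δ N)^[k] (fun ψ => max (-c) (min c (latticePhi4Action J lam ψ))
          - gibbsExpect J lam (fun ψ => max (-c) (min c (latticePhi4Action J lam ψ))))) φ
        * gibbsWeight J lam φ)
        / ∫ φ, (max (-c) (min c (latticePhi4Action J lam φ))
          - gibbsExpect J lam (fun ψ => max (-c) (min c (latticePhi4Action J lam ψ)))) ^ 2
          * gibbsWeight J lam φ) :=
  hmcPhi4_tauInt_ge_action hlam J δ N (clipAction_bddObs J lam c)
    (fun ψ φ => clipAction_lipschitz_global J lam c ψ φ) hs hρ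

end ActionCSD

end Summit.Ventures.LatticeQCDFlow.Exactness
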